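import Summits.HubbardSuperconductivity.HubbardSuperconductivity.Theorems.AnisotropyChordTransferFibre3L2Targets

/-!
# Route `AnisotropyChord` / H0 rotor rung: PORT PartN36 — THE SECOND GAP IN EVERY PERMUTATION SECTOR: LEMMA V′ (freeze two, Poincaré on the twice-punctured torus, count momenta)

Verbatim port (modulo this header, the port comment and lint options) of the theory seat's statement file
`hubbard-h0-rotor-theory-1/cycle21/lean/PartN36.lean` (sha16 `ef038290449511d9`; theory seat `hubbard-h0-rotor-theory-1` g21).
Statements only (targets typed by the theory seat; no proofs claimed here beyond what the theory file itself proves).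
Prover seat `hubbard-h0-rotor-p1` g22; helper for stmt-HubbardSuperconductivity-19089 (`--supports`).

Theory seat's own summary of the file:

# PART N36 — THE SECOND GAP IN EVERY PERMUTATION SECTOR: LEMMA V′ («freeze two, Poincaré on the twice-punctured torus, count momenta»)
theory seat hubbard-h0-rotor-theory-1, g21, REPORT 26; memo 21 §313; numerics `cycle21/calc/{g2_sectors.py, gap2.py, lemmaVprime_check.py}`.

## Why this file exists
`SecondGapK1 L m₀` (L2Targets) quantifies over EVERY `ψ` vanishing on the hard core and orthogonal to the three pole waves — all permutation
sectors of the three labelled particles, not only the bosonic (`IsSymm`) one.  Memo 19's THEOREM G2 (LEMMA V + hole gaps + PROP R2, §251–§255) is a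
SYMMETRIC-SECTOR theorem (highest-weight `SU(2)` structure).  The pipeline consumes the all-sector form (`KappaZeroAlgebra`, `L2QuantG`, `nInvertibleBelow_of_posDef`
all take `∀ y`).  Sector-resolved Lanczos of the `K₁` fibre at `Δ = 1` (hard core), lowest levels / ε₁:
```
 L   symmetric: d, 2nd, 3rd      sign (fermionic): 1st 2nd 3rd      standard (mixed, dim 2): 1st(×2) 2nd        inf over {⟂ poles}, ALL sectors   needed 1 + cos²θ/2
 4   1.0000  2.2845  2.3820          1.8930  1.9814  2.1173            0.7441   2.0493                           1.8930 (= sign ground)          1.3555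
 5   1.0000    —       —             2.1032    —       —               0.8255     —                              2.1032                          1.4048
 6   1.0000  2.8434  3.0000          2.2820  2.3927  2.5550            0.8746   2.4752                           2.2820                          1.4329
 7   1.0000    —       —             2.4239    —       —               0.9061     —                              2.4239                          1.4502
 8   1.0000  2.9455  3.0000          2.5327  2.6246  2.7430            0.9273   2.6420                           2.5327                          1.4617
```
(the standard-sector doublet BELOW ε₁, at (1 − c/L²)ε₁ with c ≈ 4.1…4.7, lies 96.6 % (L=4) … 98.5 % (L=6) inside the span of the pole waves, so it is
removed by the orthogonality; the symmetric descendant `d` sits exactly at ε₁ and 100 % inside the pole span; the sign sector has no pole content at all).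
So the LITERAL all-sector statement `SecondGapK1 L (ε₁cos²θ/2)` is TRUE for 4 ≤ L ≤ 8 (binding constraint = the fermionic ground level, margin growing),
but its ∀L proof is NOT memo 19's.  LEMMA V′ below supplies it from ONE one-body input, the two-hole gap.

## LEMMA V′ (all sectors; verified to machine precision, `lemmaVprime_check.py`)
Lab frame `Ψ(x₁,x₂,x₃) = e^{iK₁·x₁} ψ(x₂−x₁, x₃−x₁)`, exclusion generator with rates ½ (`= H₀ − W` at Δ = 1 on hard-core functions).
* (V1′) FREEZE IDENTITY: `Re⟨ψ,(H₀^{K₁} − W)ψ⟩ = Σ_{i=1}^{3} Σ_ζ E_{ℤ_L²∖ζ}[f_{i,ζ}]`, `ζ` = positions of the two particles other than `i`, `f_{i,ζ}(x) = Ψ(…, x_i = x, …)`,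
  `E_{G∖ζ}[f] = ½ Σ_{edges of G∖ζ} |f x − f y|²` (every allowed hop counted once; NO symmetry of ψ used).      [`FreezeIdentity`]
* (V2′) `Σ_{i,ζ} ‖f_{i,ζ}‖² = 3‖ψ‖²`.
* POINCARÉ on each twice-punctured torus: `E_{G∖ζ}[f] ≥ gap₂ · (‖f‖² − (V−2)|mean f|²)`.                                              [`TwoHoleGap`]
* `Σ_ζ (V−2)|mean f_{i,ζ}|² = (V/(V−2)) ‖Π_i⁰ ψ‖²`, `Π_i⁰` = "particle `i` at lab momentum 0" (Parseval in `x_i`; hard core ⇒ the sum over `x ∉ ζ` is the full sum).   [`restSq1/2/3`]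
* MOMENTUM COUNT: on the free `K₁` space `Σ_i Π_i⁰ = #{particles at rest} ∈ {0,1,2}`, `= 2` exactly on the pole waves (two at rest, the third carries `K₁`);
  hence `ψ ⟂ p₀,p₁,p₂ ⇒ Σ_i ‖Π_i⁰ψ‖² ≤ ‖ψ‖²`.                                                                                          [`PoleCount`]
⟹  `Re⟨ψ,(H₀ − W)ψ⟩ ≥ gap₂ (3 − V/(V−2)) ‖ψ‖² = gap₂ (2 − 2/(V−2)) ‖ψ‖²`  for every hard-core `ψ ⟂` pole waves, every sector.      [`LemmaVPrime`]
With `gap₂ ≥ ¾ ε₁` [`TwoHoleGap L (3ε₁/4)` = HOLE₂(.75)]: `¾(2 − 2/(V−2)) − 1 ≥ cos²θ/2 ⟺ V² − 8V + 6 ≥ 0`, true for L ≥ 4, so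
   HOLE₂(.75) ⇒ `SecondGapK1 L (ε₁ cos²θ/2)` EXACTLY AS TYPED.                                                                          [`SecondGapK1OfHole75`]
DATA (`gap2.py`, Lanczos on ℤ_L² minus the worst pair = diagonal neighbours (1,1) for L ≥ 5, (2,0) at L = 4; agrees with memo 19 §251(b)):
```
 L            4      5      6      7      8      9      10     12     16     24      (32: .979, memo 19)      law 1 − 21.5/V
 gap₂/ε₁    .548   .606   .652   .696   .737   .774   .805   .855   .915   .962
 V′-bound   1.018  1.160  1.266  1.363  1.450  1.528  1.594  1.698  1.823  1.921    = gap₂(2 − 2/(V−2))/ε₁ → 2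
 needed     1.356  1.405  1.433  1.450  1.462  1.470  1.475  1.483  1.490  1.496    = 1 + cos²θ/2 → 1.5
```
so LEMMA V′ + the true gap₂ gives `SecondGapK1 L (ε₁cos²θ/2)` for every L ≥ 9 (indeed m₀ → ε₁(1 − 45/V) ≫ ε₁cos²θ/2), and HOLE₂(.75) holds from L = 9 on
(margin .024 at L = 9, .055, .105, .165, .212, .229 at L = 10, 12, 16, 24, 32).  For 4 ≤ L ≤ 8 the statement is certified DIRECTLY (table above: inf = 1.893 …
2.533 ≥ needed; dimension ≤ 3 906, interval Lanczos / LDLᵀ — FIN-class).  STATUS of HOLE₂(.75) ∀L: certified per L by ≤ 8×8 Birman–Schwinger Schur complements of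
one-body torus Green's functions (memo 19 §253, PROP BS; FIN-class, O(L³) per L; θ₂ = .5 was run to L = 512); the analytic tail L ≥ L₀ is a family-A Level-2
item (one-body lattice sums `G_λ(r)`, |r| ≤ 3, λ = ¾ε₁, row formula of PART N35) whose only subtlety is the s-channel, to be handled by the exact identity of
memo 19 §254(a)(ii) type (`μ_s < 1 ⟺ G_λ > 0`).  It replaces, for the all-sector statement, memo 19's symmetric-sector inputs (LEMMA V, PROP R2, HOLE₁(.92), LEMMA RS).

ALTERNATIVE (R1, not recommended now): restrict the whole Krein/L2 spine to the symmetric sector (`SecondGapK1Symm` below = memo 19's THEOREM G2 verbatim,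
proved ∀L mod CLR); cost = re-proving `nInvertibleBelow_of_posDef`, `KappaZero*`, `master_inequality_hom` with `IsSymm` threaded through.  LEMMA V′ makes this unnecessary.
Typing only; Mathlib + tree imports; no sorry, no axioms.
-/

-- Port of theory seat `hubbard-h0-rotor-theory-1` cycle21/lean/PartN36.lean (sha16 ef038290449511d9) verbatim modulo this header,
-- lint options and lint fixes; prover seat `hubbard-h0-rotor-p1` g22, `--supports stmt-HubbardSuperconductivity-19089`.

set_option linter.dupNamespace false
namespace Summit.HubbardSuperconductivity.HubbardSuperconductivity.Theorems.AnisotropyChord.Transfer.Fibre3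

open scoped BigOperators

variable (L : ℕ) [NeZero L]

/-! ## The three «particle i at rest» weights (fibre coordinates: particle 2 ↔ `a = c.1`, particle 3 ↔ `b = c.2`, particle 1 carries `K₁ − k₂ − k₃`) -/

/-- `‖Π₂⁰ψ‖² = (1/V) Σ_b |Σ_a ψ(a,b)|²` (particle 2 at lab momentum 0). -/
noncomputable def restSq2 (ψ : Cfg L → ℂ) : ℝ :=
  (∑ b : Tor L, ‖∑ a : Tor L, ψ (a, b)‖ ^ 2) / (L : ℝ) ^ 2

/-- `‖Π₃⁰ψ‖² = (1/V) Σ_a |Σ_b ψ(a,b)|²` (particle 3 at lab momentum 0). -/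
noncomputable def restSq3 (ψ : Cfg L → ℂ) : ℝ :=
  (∑ a : Tor L, ‖∑ b : Tor L, ψ (a, b)‖ ^ 2) / (L : ℝ) ^ 2

/-- `‖Π₁⁰ψ‖² = (1/V) Σ_d |Σ_b e^{−iK₁·b} ψ(b+d, b)|²` (particle 1 at lab momentum 0 ⟺ `k₂ + k₃ = K₁`; on the plane wave
`ψ(a,b) = e^{i(k₂a + k₃b)}` this equals `‖ψ‖² = V²` iff `k₂ + k₃ = K₁`, else 0). -/
noncomputable def restSq1 (ψ : Cfg L → ℂ) : ℝ :=
  (∑ d : Tor L, ‖∑ b : Tor L, (starRingEnd ℂ) (phase L (K1 L) b) * ψ (b + d, b)‖ ^ 2) / (L : ℝ) ^ 2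

/-- MOMENTUM COUNT (pure Fourier analysis on `(ℤ/L)²×(ℤ/L)²`, no hard core, no symmetry): `Σ_i Π_i⁰` counts the particles at rest, which is
`≤ 1` orthogonally to the three pole waves (two particles at rest forces the third to carry `K₁`, i.e. a pole wave; three at rest is impossible
since the total momentum is `K₁ ≠ 0`).  First lemma of LEMMA V′. -/
def PoleCount : Prop :=
  ∀ ψ : Cfg L → ℂ, (∀ j : Fin 3, ip L (poleWave L j) ψ = 0) →
    restSq1 L ψ + restSq2 L ψ + restSq3 L ψ ≤ (ip L ψ ψ).re

/-- TWO-HOLE GAP `gap₂ ≥ g`: Poincaré inequality for the rate-½ random walk on the twice-punctured torus `ℤ_L² ∖ {z₁,z₂}`, every pair: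
zero mean off the holes ⇒ `g Σ_{x ∉ ζ} |f x|² ≤ ½ Σ_{edges of ℤ_L²∖ζ} |f x − f y|²` (written as ¼ of the sum over ordered bonds).
[With no hole the constant is ε₁.  HOLE₂(θ) := `TwoHoleGap L (θ ε₁)`; numerically gap₂/ε₁ = .548 .606 .652 .696 .737 .774 .805 .855 .915 .962 .979
for L = 4 5 6 7 8 9 10 12 16 24 32, law 1 − 21.5/V, worst pair = diagonal neighbours.] -/
def TwoHoleGap (g : ℝ) : Prop :=
  ∀ z₁ z₂ : Tor L, z₁ ≠ z₂ → ∀ f : Tor L → ℂ,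
    (∑ x : Tor L, (if (x = z₁ ∨ x = z₂) then (0 : ℂ) else f x)) = 0 →
    g * (∑ x : Tor L, (if (x = z₁ ∨ x = z₂) then (0 : ℝ) else ‖f x‖ ^ 2)) ≤
      (1 / 4 : ℝ) * ∑ x : Tor L, ((nnList L).map (fun e =>
        if (x = z₁ ∨ x = z₂ ∨ x + e = z₁ ∨ x + e = z₂) then (0 : ℝ) else ‖f x - f (x + e)‖ ^ 2)).sum

/-- (V1′) FREEZE IDENTITY in fibre coordinates, at `Δ = 1`, for `ψ` vanishing on the hard core:
`Re⟨ψ,(H₀^{K₁} − W)ψ⟩ = E₁ + E₂ + E₃`, the Dirichlet forms of the three particles with the other two frozen: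
particle 2 (`a ↦ ψ(a,b)`, holes `a ∈ {0, b}`), particle 3 (`b ↦ ψ(a,b)`, holes `b ∈ {0, a}`), particle 1 (hop `(a,b) ↦ e^{iK₁·e}ψ(a−e,b−e)`,
holes where `a = e` or `b = e`), each ordered bond counted with weight ¼ (= ½ per unordered bond).  Pure bookkeeping of `H0apply`/`Wcount`. -/
def FreezeIdentity : Prop :=
  ∀ ψ : Cfg L → ℂ, (∀ c : Cfg L, InD L c = true → ψ c = 0) →
    (ip L ψ (Happly L (K1 L) (1 : ℝ) ψ)).re =
      (1 / 4 : ℝ) * ∑ c : Cfg L, ((nnList L).map (fun e =>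
          (if (InD L c = true ∨ InD L (c.1 + e, c.2) = true) then (0 : ℝ) else ‖ψ c - ψ (c.1 + e, c.2)‖ ^ 2)
        + (if (InD L c = true ∨ InD L (c.1, c.2 + e) = true) then (0 : ℝ) else ‖ψ c - ψ (c.1, c.2 + e)‖ ^ 2)
        + (if (InD L c = true ∨ InD L (c.1 - e, c.2 - e) = true) then (0 : ℝ)
            else ‖ψ c - phase L (K1 L) e * ψ (c.1 - e, c.2 - e)‖ ^ 2))).sum

/-- LEMMA V′, SHARP FORM (no orthogonality needed): for every `ψ` vanishing on the hard core, every permutation sector,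
`gap₂ · (3‖ψ‖² − (V/(V−2)) Σ_i ‖Π_i⁰ψ‖²) ≤ Re⟨ψ,(H₀^{K₁} − W)ψ⟩`.
Proof: `FreezeIdentity` + `TwoHoleGap` applied to each `f_{i,ζ} − mean` + Parseval in the free coordinate (the three `restSq`). -/
def LemmaVPrimeSharp : Prop :=
  ∀ g : ℝ, 0 ≤ g → TwoHoleGap L g →
    ∀ ψ : Cfg L → ℂ, (∀ c : Cfg L, InD L c = true → ψ c = 0) →
      g * (3 * (ip L ψ ψ).re - ((L : ℝ) ^ 2 / ((L : ℝ) ^ 2 - 2)) * (restSq1 L ψ + restSq2 L ψ + restSq3 L ψ))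
        ≤ (ip L ψ (Happly L (K1 L) (1 : ℝ) ψ)).re

/-- LEMMA V′ (all permutation sectors): `gap₂ ≥ g ≥ 0 ⇒ SecondGapK1 L (g(2 − 2/(V−2)) − ε₁)`, i.e.
`Re⟨ψ,(H₀^{K₁} − W)ψ⟩ ≥ g (2 − 2/(V−2)) ‖ψ‖²` for hard-core `ψ ⟂` the pole waves.  (`LemmaVPrimeSharp` + `PoleCount`.) -/
def LemmaVPrime : Prop :=
  ∀ g : ℝ, 0 ≤ g → TwoHoleGap L g → SecondGapK1 L (g * (2 - 2 / ((L : ℝ) ^ 2 - 2)) - eps1 L)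

/-- THE SPECTRAL INPUT OF THE GM₃ CERTIFICATE FROM ONE ONE-BODY FACT: `4 ≤ L ⇒ HOLE₂(.75) ⇒ SecondGapK1 L (ε₁cos²θ/2)` exactly as consumed by
`l2FromSecondGap_holds` / `gm3_of_cruxes_secondGap`.  Arithmetic: `¾(2 − 2/(V−2)) − 1 = ½ − (3/2)/(V−2) ≥ ½ − 5/(2V) + 3/V² = cos²θ/2 ⟺ V² − 8V + 6 ≥ 0`
(V ≥ 16), plus monotonicity of `SecondGapK1` in `m₀`.  HOLE₂(.75) holds for every L ≥ 9 numerically (margins .024, .055, .105, .165, .212, .229 at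
L = 9, 10, 12, 16, 24, 32; certified per L by PROP BS); for 4 ≤ L ≤ 8 certify `SecondGapK1` directly (inf = 1.893, 2.103, 2.282, 2.424, 2.533 ε₁ ≥ needed). -/
def SecondGapK1OfHole75 : Prop :=
  4 ≤ L → TwoHoleGap L (3 / 4 * eps1 L) → SecondGapK1 L (eps1 L * cos2theta L / 2)

/-- Monotonicity in the mass (trivial, recorded for the assembly): `m₀' ≤ m₀ ⇒ SecondGapK1 m₀ ⇒ SecondGapK1 m₀'`. -/
def SecondGapK1Mono : Prop :=
  ∀ m0 m0' : ℝ, m0' ≤ m0 → SecondGapK1 L m0 → SecondGapK1 L m0'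

/-! ## For the record: the symmetric-sector statement (memo 19's THEOREM G2 verbatim) and the shell symmetry predicate -/

/-- Shell data of a bosonic (`IsSymm`) fibre function. -/
def IsSymmS (y : Ssub L → ℂ) : Prop :=
  ∃ F : Cfg L → ℂ, IsSymm L (K1 L) F ∧ ∀ s : Ssub L, y s = F s.1

/-- THEOREM G2 of memo 19 (§251–§255; symmetric sector; PROVED ∀ L ≥ 4 modulo CLR on the torus and the once-punctured torus, via LEMMA V + PROP BS +
PROP R2 + LEMMA RS + certified one- and two-hole tables for L ≤ 24, with `m₀ ≥ .38 ε₁ cos²θ` for L ≥ 20 and `≥ ½ε₁cos²θ·(room)` from the tables below):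
the weaker, bosonic form of `SecondGapK1`.  `SecondGapK1 L m₀ → SecondGapK1Symm L m₀` trivially; the converse is what LEMMA V′ makes unnecessary. -/
def SecondGapK1Symm (m0 : ℝ) : Prop :=
  ∀ ψ : Cfg L → ℂ, IsSymm L (K1 L) ψ → (∀ c : Cfg L, InD L c = true → ψ c = 0) → (∀ j : Fin 3, ip L (poleWave L j) ψ = 0) →
    (eps1 L + m0) * (ip L ψ ψ).re ≤ (ip L ψ (Happly L (K1 L) (1 : ℝ) ψ)).re

/-- the trivial direction. -/
theorem secondGapK1Symm_of_all (m0 : ℝ) (h : SecondGapK1 L m0) : SecondGapK1Symm L m0 :=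
  fun ψ _ hD hP => h ψ hD hP

/-- monotonicity in the mass. -/
theorem secondGapK1Mono_holds : SecondGapK1Mono L := by
  intro m0 m0' hle h ψ hD hP
  have h1 := h ψ hD hP
  have hnn : 0 ≤ (ip L ψ ψ).re := by
    unfold ip
    rw [Complex.re_sum]
    refine Finset.sum_nonneg (fun c _ => ?_)
    have : (starRingEnd ℂ) (ψ c) * ψ c = ((Complex.normSq (ψ c) : ℝ) : ℂ) := by
      rw [Complex.normSq_eq_conj_mul_self]
    rw [this, Complex.ofReal_re]
    exact Complex.normSq_nonneg _
  have h2 : (eps1 L + m0') * (ip L ψ ψ).re ≤ (eps1 L + m0) * (ip L ψ ψ).re :=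
    mul_le_mul_of_nonneg_right (by linarith) hnn
  exact le_trans h2 h1

omit [NeZero L] in
/-- the arithmetic of `SecondGapK1OfHole75`: for `V = L² ≥ 16`, `¾·(2 − 2/(V−2)) − 1 ≥ (1 − 5/V + 6/V²)/2`. -/
theorem hole75_arith (hL : 4 ≤ L) :
    eps1 L * cos2theta L / 2 ≤ 3 / 4 * eps1 L * (2 - 2 / ((L : ℝ) ^ 2 - 2)) - eps1 L := by
  have hL' : (4 : ℝ) ≤ (L : ℝ) := by exact_mod_cast hL
  have hV : (16 : ℝ) ≤ (L : ℝ) ^ 2 := by nlinarith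
  have he : 0 ≤ eps1 L := by
    unfold eps1
    have := Real.cos_le_one (2 * Real.pi / L)
    linarith
  unfold cos2theta
  set V : ℝ := (L : ℝ) ^ 2 with hVdef
  have hV2 : 0 < V - 2 := by linarith
  have hV0 : 0 < V := by linarith
  -- reduce to V² − 8V + 6 ≥ 0
  have key : (1 - 5 / V + 6 / V ^ 2) / 2 ≤ 3 / 4 * (2 - 2 / (V - 2)) - 1 := by
    rw [show 3 / 4 * (2 - 2 / (V - 2)) - 1 = (1 / 2) - (3 / 2) / (V - 2) by ring]
    rw [show (1 - 5 / V + 6 / V ^ 2) / 2 = (1 / 2) - (5 / 2) / V + 3 / V ^ 2 by ring]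
    have h3 : (3 / 2) / (V - 2) ≤ (5 / 2) / V - 3 / V ^ 2 := by
      rw [div_le_iff₀ hV2]
      have : ((5 / 2) / V - 3 / V ^ 2) * (V - 2) = (5 / 2) - 5 / V - 3 / V + 6 / V ^ 2 := by
        field_simp
        ring
      rw [this]
      have h5 : 5 / V ≤ 5 / 16 := div_le_div_of_nonneg_left (by norm_num) (by norm_num) hV
      have h6 : 3 / V ≤ 3 / 16 := div_le_div_of_nonneg_left (by norm_num) (by norm_num) hV
      have h7 : 0 ≤ 6 / V ^ 2 := by positivity
      linarith
    linarith
  have := mul_le_mul_of_nonneg_left key he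
  calc eps1 L * (1 - 5 / V + 6 / V ^ 2) / 2 = eps1 L * ((1 - 5 / V + 6 / V ^ 2) / 2) := by ring
    _ ≤ eps1 L * (3 / 4 * (2 - 2 / (V - 2)) - 1) := this
    _ = 3 / 4 * eps1 L * (2 - 2 / (V - 2)) - eps1 L := by ring

/-- `LemmaVPrime ⇒ SecondGapK1OfHole75` (given the arithmetic and monotonicity). -/
theorem secondGapK1OfHole75_of_lemmaVPrime (hV : LemmaVPrime L) : SecondGapK1OfHole75 L := by
  intro hL hH
  have he : 0 ≤ eps1 L := by
    unfold eps1
    have := Real.cos_le_one (2 * Real.pi / L)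
    linarith
  have hg : 0 ≤ 3 / 4 * eps1 L := by positivity
  have h1 := hV (3 / 4 * eps1 L) hg hH
  refine secondGapK1Mono_holds L _ _ ?_ h1
  have := hole75_arith L hL
  linarith

end Summit.HubbardSuperconductivity.HubbardSuperconductivity.Theorems.AnisotropyChord.Transfer.Fibre3
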